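import Summits.BirchSwinnertonDyer.BirchSwinnertonDyer.Theorems.ByReductionTypeAtTwoAdditiveKatoTransportDefs
import HarnessLib

/-!
# Route ByReductionTypeAtTwo, crux `AdditiveRankZeroAtTwo` (stmt-BirchSwinnertonDyer-19098) — T20's typed input with the
# `Λ`-CONVENTION PINNED (pen RC-364 (1), audit point AP4): the odd-branch package with the exceptional prime at `(T − 4)`
# (the tree's contragredient key-`γ` convention — EXPECTED) and, as a separately NAMED input, at `(5T + 4)` (Kato's natural
# convention); each implies the convention-agnostic input `KatoOddBranchInputsAtTwoNegOneSplitTwist` consumed by the doors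

Seat `bsd-2adic-addL2x` GEN 16. Pen RC-364 (1) on AP4: «the door must USE ONE convention consistently and say which in its
docstring — if both readings of the typed input are needed anywhere, split it into two named inputs rather than one ambiguous one».
The landed input `AddKatoTwo.KatoOddBranchInputsAtTwoNegOneSplitTwist` (p680350) quantifies `∃ π ∈ {5T+4, T−4}`; this file names the
two readings separately and records WHICH ONE the tree's conventions select:

* The tree's dual Selmer data `W.SelmerDualData κ γ` let `T` act by PRE-composition with `conj_γ` (`SelmerDualData.toDual_T_smul`),
  i.e. `1 + T` acts as `x ↦ x ∘ conj_γ` — the CONTRAGREDIENT of the natural (transport-of-structure) action, for which `γ` would act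
  as `x ↦ x ∘ conj_{γ⁻¹}`; so a key-`γ` datum is the `ι`-TWIST `X^ι` of Kato's naturally-acted module (module docstring of
  `Literature/…/Kato2004/IwasawaInvolutionTwistProofs.lean`; cell `bsd-wall` convention audit G4). Kato's local term
  `𝐇²_loc = lim H²(ℚ₂(ζ_{2ⁿ}), T₂E) ≅ (μ_{2^∞})^∨ = ℤ₂(−1)` carries the natural action `σ ↦ κ(σ)⁻¹`, i.e. it is `Λ/(γ − κ(γ)⁻¹) =
  Λ/(5T + 4)` naturally (`κ(γ) = 5`, `IsCyclotomicVariable`); a package over the tree's `D.X` carries the twisted structure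
  throughout (its maps are `Λ`-linear), so there the local term is `Λ/ι(5T+4) = Λ/(T − 4)` (`ℓ_𝔓(M^ι) = ℓ_{ι𝔓}(M)`,
  `Kato2004.lengthAt_eq_of_involSemilinear`; `(1+T)·ι(T−4) = −(5T+4)`, `AddKatoTwo.one_add_X_mul_invol_X_sub_four`), and the
  Coleman image is `G ≐ 2ⁿ·(T−4)·ι(L⁻) ≐ 2ⁿ·(T−4)·L⁻` by the functional equation `ι L⁻ = unit·L⁻` (MTT §I.17, PRINT).
  **EXPECTED reading: `π = T − 4`** (`KatoOddBranchInputsAtTwoNegOneSplitTwistContra` below).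
* `KatoOddBranchInputsAtTwoNegOneSplitTwistNat` (`π = 5T + 4`) is the same package in Kato's natural convention, recorded as a
  separate name only so that no consumer ever depends on an ambiguous input; it is NOT expected to be the tree's reading.
* Both imply the landed `KatoOddBranchInputsAtTwoNegOneSplitTwist` (pure logic), which is what the doors
  `lengthAt_selmerDual_le_of_oddBranchInputs` (p682028) / `…_of_decomposition` consume; those doors are convention-ROBUST
  (they decide `π ∉ 𝔮 ∨ π ∉ ι𝔮` in the kernel), so pinning the convention changes no conclusion — it only names the input
  the cell expects to discharge (the odd-branch twin of K11b, memo PROOF-KATO2SPLIT's Coleman clause, in the tree convention).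
* CAVEAT (cell `bsd-cited` ARM-P register, flag `Kato-1713-dual-action`, file `Kato2004/DivisibilityInputsContragredient.lean`):
  like K11b, a package `MultDivisibilityInputs W 2 L κ γ I D` pairs the COVARIANT `I = 𝐇¹_Γ` (`T = conj_γ − 1`) with the
  CONTRAGREDIENT key-`γ` datum `D`, so it is «stronger than print by ι AS A PACKAGE» (one crossing map is `Λ`-linear only up
  to an `ι`-symmetry); the PRINT-EXACT home is the twin structure `Kato2004.MultDivisibilityInputsContra W 2 L κ γ I D'` with
  `D' : W.SelmerDualData κ γ⁻¹`, where the exceptional prime is Kato's natural `(5T + 4)`. Typing that twin of the input (and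
  the `…Contra` twins of the kernel files `DivisibilityInputsExceptionalTransport{,Length}Proofs`) is left to the successor; the
  END statements (the doors' conclusions at every height-one `𝔮 ∌ 2`, the block targets) are `ι`-SAFE: they hold for either
  key and transfer between `D` and `D'` by `ℓ_𝔮(D.X) = ℓ_{ι𝔮}(D'.X)` and the functional equation.

HONEST FRAMING (cell `bsd-2adic`, D-0036/D-0054): two typed constants (nothing asserted) + two one-line implications; types-the-
object-of; closes none; nothing booked; BSD is not proved by any of this.

References: [Kato2004Asterisque] §12.2 (p. 220), Thm. 12.5 (3) with (12.5.1) (p. 222), 13.13 (pp. 233–234), §17.13 (p. 280);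
[Greenberg1989] pp. 101–102 (`S^ι`); [GreenbergLNM1716] §1 (p. 60); [MazurTateTeitelbaum1986Invent] §I.17; memo
`run/shared/lean/pub/bsd-2adic/addL2x/VERDICT-19098-addL2x-GEN16.md`.
-/

set_option autoImplicit false
-- the summit's namespace `Summit.BirchSwinnertonDyer.BirchSwinnertonDyer` (Sub = Summit) trips `dupNamespace`
set_option linter.dupNamespace false

noncomputable section

open scoped Classical MatrixGroups ModularForm

open Field CongruenceSubgroup WeierstrassCurve Literature.NumberTheory.EllipticCurves
  Literature.NumberTheory.EllipticCurves.ModularForms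

namespace Summit.BirchSwinnertonDyer.BirchSwinnertonDyer.Theorems.AddKatoTwo

/-- The odd-branch §17.13 package at `p = 2` for `W` with `W^{(−1)}` split multiplicative, with the factor / exceptional prime
PINNED at `π` (shared body of the two named readings below; a predicate in `π`, nothing asserted). [folklore] -/
def KatoOddBranchInputsAtTwoNegOneSplitTwistAt (π : IwasawaAlgebra 2) : Prop :=
  ∀ (W : WeierstrassCurve ℚ) [W.IsElliptic] [W.IsGloballyMinimal]
    [ContinuousSMul ℤ_[2] (W.tateModule 2)] {N : ℕ} [NeZero N] (f : CuspForm (Gamma0 N) 2)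
    (κ : ZpExtension ℚ 2) (γ : absoluteGaloisGroup ℚ),
    (W.quadraticTwist (-1)).HasSplitMultiplicativeReductionAtPrime 2 → W.HasIrreducibleModPGaloisRep 2 →
    κ.IsCyclotomic → κ.IsTopGenerator γ → IsCyclotomicVariable 2 γ → IsNewformOf (W.quadraticTwist (-1)) f →
    ∀ (I : Kato2004.IwasawaH1Data W 2 κ γ) (D : W.SelmerDualData κ γ),
      ∃ K : Kato2004.MultDivisibilityInputs W 2
          (iwasawaToPowerSeries 2 π * padicLFunctionMinusBranchMult f (1 : ℚ_[2]) 1) κ γ I D,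
        (∀ 𝔮 : PrimeSpectrum (IwasawaAlgebra 2), 𝔮.asIdeal.height = 1 →
            PowerSeries.C (2 : ℤ_[2]) ∉ 𝔮.asIdeal →
            Module.lengthAt (IwasawaAlgebra 2) (IwasawaAlgebra 2 ⧸ LinearMap.range K.col) 𝔮 = 0) ∧
        (∀ 𝔮 : PrimeSpectrum (IwasawaAlgebra 2), 𝔮.asIdeal.height = 1 →
            PowerSeries.C (2 : ℤ_[2]) ∉ 𝔮.asIdeal → 𝔮.asIdeal ≠ Ideal.span {π} →
            Module.lengthAt (IwasawaAlgebra 2) K.H2loc 𝔮 = 0)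

/-- [crux input, MEMO — THE EXPECTED READING] **The odd-branch Kato–Coleman package at `2` for the (−1)-split additive class IN
THE TREE'S (contragredient, key-`γ`) `Λ`-CONVENTION: exceptional prime `(T − 4)`, Coleman image `≐ 2ⁿ·(T−4)·L⁻`.** Content and
status exactly as `KatoOddBranchInputsAtTwoNegOneSplitTwist` (T20 (b); conjecture-grade at `2`, print at odd `p` — the odd-branch
twin of `MultKatoInputs.exists_multDivisibilityInputs_split_two`), with `π = T − 4` (module docstring: why this is the reading
the tree's conventions select). [cite: Kato2004Asterisque, Thm. 12.4 (1) (p. 221), Thm. 12.5 (1)–(3) with (12.5.1) (pp. 221–222), Thm. 12.6 (p. 222), 13.13 (pp. 233–234), §16.1 and Thm. 16.2, 16.6 (pp. 268–271), §17.13 (pp. 279–280)]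
[cite: Kobayashi2006DocMath, Thm. 4.1 (odd p)] [cite: Greenberg1989, pp. 101–102 (S^ι)] -/
@[conjecture] def KatoOddBranchInputsAtTwoNegOneSplitTwistContra : Prop :=
  KatoOddBranchInputsAtTwoNegOneSplitTwistAt (PowerSeries.X - PowerSeries.C 4)

/-- [crux input, MEMO — the OTHER reading, recorded as a separate name per RC-364 (1)] The same package IN KATO'S NATURAL
`Λ`-CONVENTION: exceptional prime `(5T + 4) = (γ − κ(γ)⁻¹)`. Not expected to be the tree's reading (module docstring); kept so
that no consumer depends on an ambiguous input. [cite: Kato2004Asterisque, Thm. 12.5 (3) with (12.5.1) (p. 222), 13.13 (pp. 233–234), §17.13 (pp. 279–280)]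
[cite: Kobayashi2006DocMath, Thm. 4.1 (odd p)] -/
@[conjecture] def KatoOddBranchInputsAtTwoNegOneSplitTwistNat : Prop :=
  KatoOddBranchInputsAtTwoNegOneSplitTwistAt (PowerSeries.C 5 * PowerSeries.X + PowerSeries.C 4)

/-- The pinned (tree-convention) reading implies the convention-agnostic input of the doors (pure logic).
[cite: Kato2004Asterisque, Thm. 12.5 (3) with (12.5.1) (p. 222)] -/
theorem katoOddBranchInputsAtTwoNegOneSplitTwist_of_contra (h : KatoOddBranchInputsAtTwoNegOneSplitTwistContra) :
    KatoOddBranchInputsAtTwoNegOneSplitTwist := by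
  intro W _ _ _ N _ f κ γ hsp hirr hκ hγ hγ' hf I D
  obtain ⟨K, h1, h2⟩ := h W f κ γ hsp hirr hκ hγ hγ' hf I D
  exact ⟨PowerSeries.X - PowerSeries.C 4, Or.inr rfl, K, h1, h2⟩

/-- The natural-convention reading implies the convention-agnostic input of the doors (pure logic).
[cite: Kato2004Asterisque, Thm. 12.5 (3) with (12.5.1) (p. 222)] -/
theorem katoOddBranchInputsAtTwoNegOneSplitTwist_of_nat (h : KatoOddBranchInputsAtTwoNegOneSplitTwistNat) :
    KatoOddBranchInputsAtTwoNegOneSplitTwist := by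
  intro W _ _ _ N _ f κ γ hsp hirr hκ hγ hγ' hf I D
  obtain ⟨K, h1, h2⟩ := h W f κ γ hsp hirr hκ hγ hγ' hf I D
  exact ⟨PowerSeries.C 5 * PowerSeries.X + PowerSeries.C 4, Or.inl rfl, K, h1, h2⟩

end Summit.BirchSwinnertonDyer.BirchSwinnertonDyer.Theorems.AddKatoTwo

end
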